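import Summits.QuantumFields.BalabanUV.T4Continuum.Spine.NE1p.DressedSmallFieldOnCores

/-!
# T⁴ programme, spine estimate NE1′ (node O3b/H2) — (B3) FOR THE CORES' END IS A SCALAR LETTER BUDGET: N0p's binder `hL3`
# (the (2.38)-shape of the cores' parameter-mass INTEGRALS) REPLACED, BY NAME over row NE5's Gaussian majorant lemmas, by the
# same (2.38)-shape on the cores' SCALAR LETTERS `λ(univ)·wB·N₀·e^{b}·(π∕(m∕2))^{dim∕2}·e^{N₁R₀}` — row NE5's `paramMass` currency

Cell `pub-balaban`, sub-cell `t4`, BINDER-OWNERS row NE1′; owner lineage t4-ne1p-p1 (PROVER seat P1, «RG-trajectory comparison …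
μ-uniformity through the printed small-field bounds»), generation 28; ADDITIVE — imports the owner's N0p
`Spine/NE1p/DressedSmallFieldOnCores` (p224732) ONLY (row NE5's `Support/OutputRateOpGaussianParam` — `paramMass`,
`norm_paramIntegrand_le`, `integrable_paramMajorant`, `integral_paramMajorant` — lies in its import cone); THEOREMS ONLY (0 def,
0 `def … : Prop`, 0 cite); nothing of N0p ∕ N0o ∕ row NE5's modules is restated — their declarations are used BY NAME.

WHY THIS FILE (HANDOFF gen 27 → 28 item (5)(b): «a typing of the parameter-mass budget in (2.38)-shape (G-ne9p2-5 = (B3)) to import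
BY NAME into N0p's `hL3`» — row NE5 HAS that typing: `OutputRateOpGaussianParam.paramMass`).  N0p's cores ENDs
`attachedPart_locE_le_of_cores{,_pencil}` leave (B3) displayed as `hL3`: for every polymer `Z` inside `X₀`, the sum over its terms
of the parameter MASSES `∫‖w(p)N(o,p)·(chi(v)e^{−q(o,p,v)})‖ d(lam ⊗ vol)` times the read-out growth `e^{N₁R₀}` has the
(2.38)-shape `(A₀ + ϱA₁)·e^{−R d(Z)}`.  Those masses are INTEGRALS over the contour-parameter × fluctuation-field space.  Row
NE5's `OutputRateOpGaussianParam` bounds exactly this integrand by the shifted Gaussian majorant `w₀N₀·G₀e^{b}·e^{−(m∕2)‖v‖²}`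
(`norm_paramIntegrand_le`) whose mass is `λ(univ)·w₀N₀G₀e^{b}·(π∕(m∕2))^{dim V∕2}` (`integral_paramMajorant`) = its letter
`paramMass` — the currency in which NE5's own END takes its (2.38)-budget (`OutputRateGaussianParamBiEnd.termBound_of_bi`,
`B13TermCoreMass.factorMass`).  For a core the weight bound is its letter `wB`, the insertion is `chi` with `‖chi‖ ≤ 1`
(`BiCore.norm_chi_le_one`, so `G₀ = 1`), and `N₀`, `m`, `b` are the operator letters ALREADY displayed in N0p's ENDs (`hN`, `hm`,
`hq`).  Hence:
* §1 (kernel, one core) `norm_integral_coreDensity_le` — for a core `𝔤`, an operator set `𝒪` carrying the letters `‖N o p‖ ≤ N₀`,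
  `m‖v‖² − b ≤ Re q(o,p,v)` (`0 < m`) and `o ∈ 𝒪`: `∫‖w·N o·(chi·e^{−q o})‖ d(lam ⊗ vol) ≤ λ(univ)·(wB·N₀·e^{b})·(π∕(m∕2))^{dim V∕2}`
  (row NE5's three lemmas BY NAME; `integral_mono_of_nonneg`); `coreMass_eq_paramMass` — that scalar IS row NE5's `paramMass` at
  the table-blind letter families of a core family with `G₀ := 1` (definitional).
* §2 (kernel) `sum_coreMass_le_sum_letters` — the per-polymer sum of N0p's `hL3` is at most the same sum on the letters, at any
  operator point of the open letter ball; ENDs `attachedPart_locE_le_of_cores_mass` ∕ `attachedPart_locE_le_of_cores_pencil_mass`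
  = N0p §4's two ENDs with `hL3` REPLACED by **`hM3`**: `Σ_{i ∈ terms Z} λ_i(univ)·(wB_i·N₀_i·e^{bq_i})·(π∕(mq_i∕2))^{dim α_i∕2}·
  e^{N₁,i·R₀} ≤ (A₀ + ϱA₁)·e^{−R d(Z)}` for `Z` inside `X₀` (the operator point's membership in the open letter ball comes from the
  pencil's class membership at `s = 0`, resp. from `hO`, and the room `hroom`) — every other binder VERBATIM N0p's.
* §3 (kernel) `muPart_locE_le_of_cores` ∕ `muPart_locE_le_of_cores_mass` — the source-pencil twins (N0p §3's
  `muPart_locE_le_of_expLinear` fired on cores exactly as N0p §4 fires the attached part, then `hL3 ↦ hM3` the same way).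

WHAT THIS DOES TO THE WALL (owner's reading; nothing re-labelled here).  For dressed activities built from (2.14)-cores of the
format of record, the bracket's «(B3) [Balaban1988RGII] Lemma 3 (2.38) at C₃(E₀+D₀) — UNINSTANTIATED = G-ne9p2-5» now reads
LITERALLY as ONE scalar inequality per polymer among finitely many LETTERS per term — parameter volume `λ(univ)` (the (2.18)
contours' lengths), Cauchy-weight bound `wB` (the (2.18) radii), Gaussian-volume bound `N₀` and margin letters `m`, `b` (rows
NE2∕NE3's Gaussian data, (2.15)–(2.17) KIND), read-out letter `N₁` (the `τ`-radii × the (1.36) table format), flat dimension — in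
the SAME currency as row NE5's (2.38)-budget (`paramMass`), so the cross-row datum G-ne9p2-5 (T4-DAG v35 Q44 (c)) is named in one
currency on both rows.  WHERE (2.38)'s decay `e^{−R d(Z)}` must come from is thereby located: the product `λ(univ)·wB` of the
term's contour letters (contour lengths × Cauchy-weight bounds — a factor of the KIND `r∕(r−1)²` per `s(Δ)`-circle of radius
`r = e^{κ₁}`, (2.15)∕(1.22); the mechanism crew row W34 exercises on a decided class), against the Gaussian letters `N₀`, `e^{b}`,
`(π∕(m∕2))^{dim∕2}` and the read-out growth `e^{N₁R₀}`.  NOTHING of (B3) is discharged: the letter inequality `hM3` is DISPLAYED; no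
numeral of print is asserted; 0 binders instantiated on Bałaban's densities; the wall line v1.6 does NOT move; NE1′ NOT printed,
NOT proved; 0∕9; count 9 unchanged.

HONEST FRAMING.  By-name compositions over SHAPES and over row NE5's PROVED lemmas; the cores are the cell's typed FORMAT of (2.14)
with letters, not Bałaban's functions; [Balaban1988RGII] (2.14)∕(2.15) p. 15, (2.18) p. 16, (2.38) p. 20 are LOCI (TYPE∕CONTEXT)
quoted in the imported modules with their tags; ABSOLUTE RULE honoured.  Rung (B)+1 on ONE finite four-torus — NOT infinite volume,
NOT a mass gap, NOT OS on ℝ⁴, NOT Clay.  HONEST DEPENDENCY: continuum YM on T⁴ ⇐ BetaPertH ∧ nine spine estimates (0/9 proved);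
BetaPertH ⇐ (D1) ∧ (D4) ∧ CAP+tail; G-an2-4 gates asym, D1 and NE2/3/4.
-/

noncomputable section

namespace Summit.QuantumFields.BalabanUV.T4Continuum.NE1p.DressedSmallFieldOnCoresMass

open Metric Set Complex MeasureTheory
open scoped BigOperators
open Literature.MathematicalPhysics.QuantumFieldTheory.Balaban1983to89 (LocDomainSys)
open Literature.MathematicalPhysics.QuantumFieldTheory.Balaban1983to89.T4OutputRate (Carriers)
open Literature.MathematicalPhysics.QuantumFieldTheory.Balaban1983to89.B13Resummation (locE Geometry)
open Literature.MathematicalPhysics.QuantumFieldTheory.Balaban1983to89.T4InputCauchyRateSpecies (ballClass)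
open Summit.QuantumFields.BalabanUV.T4Continuum.B13HistMeasurable (MeasPotFrame B13HistM)
open Summit.QuantumFields.BalabanUV.T4Continuum.B13TermParamGaussianBi (BiCore termBi)
open Summit.QuantumFields.BalabanUV.T4Continuum.OutputRateOpGaussianParam (paramMass norm_paramIntegrand_le
  integrable_paramMajorant integral_paramMajorant)
open Summit.QuantumFields.BalabanUV.T4Continuum.NE1p.DressedSmallFieldOnCores (termHistExpLinear_termBi
  attachedPart_locE_le_of_cores attachedPart_locE_le_of_cores_pencil muPart_locE_le_of_expLinear pencil_mem_ballClass
  norm_pencil_le)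

/-! ## §1 ONE CORE: the parameter mass of its density is at most row NE5's scalar letter -/

section OneCore

variable {C : Carriers} {P : MeasPotFrame C} {𝒴 : Type*} {dom : 𝒴 → C.Dom} {Op PΛ V : Type*} [MeasurableSpace PΛ]
  [NormedAddCommGroup V] [InnerProductSpace ℝ V] [FiniteDimensional ℝ V] [MeasurableSpace V] [BorelSpace V]

/-- **THE PARAMETER MASS OF A CORE'S DENSITY IS AT MOST ITS SCALAR LETTER** (kernel; row NE5's `norm_paramIntegrand_le` with the
core's weight letter `wB` and `G₀ := 1` from `BiCore.norm_chi_le_one`, integrated against the integrable shifted Gaussian majorant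
`integrable_paramMajorant` whose mass is `integral_paramMajorant`): on any operator set `𝒪` carrying the letters `‖N o p‖ ≤ N₀` and
`m‖v‖² − b ≤ Re q(o,p,v)` with `0 < m`, at every `o ∈ 𝒪`,
`∫‖w(p)·N(o,p)·(chi(v)·e^{−q(o,p,v)})‖ d(lam ⊗ vol) ≤ λ(univ)·(wB·N₀·(1·e^{b}))·(π∕(m∕2))^{dim V∕2}`. [folklore] -/
theorem norm_integral_coreDensity_le (𝔤 : BiCore P dom Op PΛ V) {𝒪 : Set Op} {m b N₀ : ℝ} (hm : 0 < m)
    (hN : ∀ o ∈ 𝒪, ∀ p, ‖𝔤.N o p‖ ≤ N₀) (hq : ∀ o ∈ 𝒪, ∀ p v, m * ‖v‖ ^ 2 - b ≤ (𝔤.q o p v).re) {o : Op} (ho : o ∈ 𝒪) :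
    ∫ z, ‖𝔤.w z.1 * 𝔤.N o z.1 * (𝔤.chi z.2 * cexp (-𝔤.q o z.1 z.2))‖ ∂(𝔤.lam.prod (volume : Measure V)) ≤
      𝔤.lam.real univ * (𝔤.wB * N₀ * (1 * Real.exp b)) * (Real.pi / (m / 2)) ^ (Module.finrank ℝ V / 2 : ℝ) := by
  haveI := 𝔤.finite
  have hg : ∀ (_ : PΛ) (v : V), ‖𝔤.chi v‖ ≤ 1 * Real.exp (m / 2 * ‖v‖ ^ 2) := fun _ v =>
    (𝔤.norm_chi_le_one v).trans (by rw [one_mul]; exact Real.one_le_exp (by positivity))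
  rw [← integral_paramMajorant 𝔤.lam hm (𝔤.wB * N₀ * (1 * Real.exp b))]
  refine integral_mono_of_nonneg (Filter.Eventually.of_forall fun _ => norm_nonneg _)
    (integrable_paramMajorant 𝔤.lam hm _) (Filter.Eventually.of_forall fun z => ?_)
  exact norm_paramIntegrand_le (g := fun _ v => 𝔤.chi v) 𝔤.norm_w_le hN hg hq ho z

end OneCore

/-! ## §2 CORE FAMILIES: N0p's (B3) binder `hL3` from the LETTER budget `hM3`; the two attached-part ENDs with `hL3 ↦ hM3` -/

section Cores

variable {C : Carriers} {P : MeasPotFrame C} {𝒴 : Type*} {dom : 𝒴 → C.Dom} {Op : Type*} [NormedAddCommGroup Op]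
  [NormedSpace ℂ Op] {ι : Type*} {β : ℕ → ι → Type*} [∀ k i, MeasurableSpace (β k i)] {α : ℕ → ι → Type*}
  [∀ k i, NormedAddCommGroup (α k i)] [∀ k i, InnerProductSpace ℝ (α k i)] [∀ k i, FiniteDimensional ℝ (α k i)]
  [∀ k i, MeasurableSpace (α k i)] [∀ k i, BorelSpace (α k i)]

omit [NormedAddCommGroup Op] [NormedSpace ℂ Op] [∀ k i, FiniteDimensional ℝ (α k i)] [∀ k i, BorelSpace (α k i)] in
/-- **THE LETTER IS ROW NE5's `paramMass`** [folklore]: for a core family `𝔊 k i X` with operator letters `mq`, `bq`, `N₀`, the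
scalar of §1 times nothing IS `OutputRateOpGaussianParam.paramMass` at the table-blind letter families
`(lam, m, b, w₀, N₀, G₀) := ((𝔊 k i X).lam, mq, bq, (𝔊 k i X).wB, N₀, 1)` (read at any table `h`), by definition — the currency of
row NE5's `termBound_of_bi` ∕ `B13TermCoreMass`. -/
theorem coreMass_eq_paramMass (𝔊 : ∀ k i, C.Dom → BiCore P dom Op (β k i) (α k i)) (mq bq N₀ : ℕ → ι → C.Dom → ℝ)
    (k : ℕ) (i : ι) (h : B13HistM P) (X : C.Dom) :
    (𝔊 k i X).lam.real univ * ((𝔊 k i X).wB * N₀ k i X * (1 * Real.exp (bq k i X))) *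
        (Real.pi / (mq k i X / 2)) ^ (Module.finrank ℝ (α k i) / 2 : ℝ) =
      paramMass α (fun k i (_ : B13HistM P) X => (𝔊 k i X).lam) (fun k i _ X => mq k i X) (fun k i _ X => bq k i X)
        (fun k i _ X => (𝔊 k i X).wB) (fun k i _ X => N₀ k i X) (fun _ _ _ _ => 1) k i h X := rfl

omit [NormedSpace ℂ Op] in
/-- **N0p's (B3) SUM IS AT MOST THE LETTER SUM** (kernel; §1 termwise): at step `k`, window point `g ∈ W`, background `U`, an
operator point `o` of the OPEN letter ball `ball (ctr k g U).1 (R′ k)` on which the letters `hm`∕`hN`∕`hq` of N0p's ENDs hold, for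
every polymer `Z` placed at scale `k` (`hscale`) and any growth factor `R₀`:
`Σ_{i ∈ terms Z} (∫‖w·N o·(chi·e^{−q o})‖)·e^{N₁R₀} ≤ Σ_{i ∈ terms Z} λ_i(univ)·(wB_i·N₀_i·(1·e^{bq_i}))·(π∕(mq_i∕2))^{dim∕2}·e^{N₁R₀}`.
[folklore] -/
theorem sum_coreMass_le_sum_letters {W : Set (ℕ → ℝ)} {ctr : ℕ → (ℕ → ℝ) → C.BgB → Op × B13HistM P} {R' : ℕ → ℝ}
    (𝔊 : ∀ k i, C.Dom → BiCore P dom Op (β k i) (α k i)) {mq bq N₀ : ℕ → ι → C.Dom → ℝ}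
    (hm : ∀ k, ∀ g ∈ W, ∀ (U : C.BgB) (X : C.Dom), C.scale X = k → ∀ i, 0 < mq k i X)
    (hNb : ∀ k, ∀ g ∈ W, ∀ (U : C.BgB) (X : C.Dom), C.scale X = k → ∀ i,
      ∀ o ∈ ball (ctr k g U).1 (R' k), ∀ p, ‖(𝔊 k i X).N o p‖ ≤ N₀ k i X)
    (hqre : ∀ k, ∀ g ∈ W, ∀ (U : C.BgB) (X : C.Dom), C.scale X = k → ∀ i,
      ∀ o ∈ ball (ctr k g U).1 (R' k), ∀ p v, mq k i X * ‖v‖ ^ 2 - bq k i X ≤ ((𝔊 k i X).q o p v).re)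
    {k : ℕ} {g : ℕ → ℝ} (hg : g ∈ W) {U : C.BgB} {o : Op} (ho : o ∈ ball (ctr k g U).1 (R' k))
    {Dom : Type*} {emb : Dom → C.Dom} (hscale : ∀ Z, C.scale (emb Z) = k) (terms : Dom → Finset ι) (R₀ : ℝ) (Z : Dom) :
    ∑ i ∈ terms Z, (∫ z, ‖(𝔊 k i (emb Z)).w z.1 * (𝔊 k i (emb Z)).N o z.1 *
        ((𝔊 k i (emb Z)).chi z.2 * cexp (-(𝔊 k i (emb Z)).q o z.1 z.2))‖ ∂((𝔊 k i (emb Z)).lam.prod volume)) *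
      Real.exp ((𝔊 k i (emb Z)).N₁ * R₀) ≤
    ∑ i ∈ terms Z, (𝔊 k i (emb Z)).lam.real univ * ((𝔊 k i (emb Z)).wB * N₀ k i (emb Z) *
        (1 * Real.exp (bq k i (emb Z)))) * (Real.pi / (mq k i (emb Z) / 2)) ^ (Module.finrank ℝ (α k i) / 2 : ℝ) *
      Real.exp ((𝔊 k i (emb Z)).N₁ * R₀) :=
  Finset.sum_le_sum fun i _ => mul_le_mul_of_nonneg_right
    (norm_integral_coreDensity_le (𝔊 k i (emb Z)) (hm k g hg U (emb Z) (hscale Z) i) (hNb k g hg U (emb Z) (hscale Z) i)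
      (hqre k g hg U (emb Z) (hscale Z) i) ho) (Real.exp_pos _).le

variable (D : LocDomainSys) {Cube : Type} [DecidableEq Cube] (G : Geometry D Cube)

open Classical in
/-- **THE ATTACHED PART OF THE DRESSED SMALL-FIELD OUTPUT BUILT FROM (2.14)-CORES, (B3) AS A LETTER BUDGET** (kernel; N0p §4's
`attachedPart_locE_le_of_cores` ONCE BY NAME with its binder `hL3` — the (2.38)-shape of the parameter-mass INTEGRALS — supplied
from **`hM3`**, the same (2.38)-shape `(A₀ + ϱA₁)·e^{−R d(Z)}` on the cores' SCALAR LETTERS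
`λ_i(univ)·(wB_i·N₀_i·e^{bq_i})·(π∕(mq_i∕2))^{dim α_i∕2}·e^{N₁,i·R₀}` summed over the terms of each polymer `Z` inside `X₀`, via §2;
the operator point lies in the open letter ball because the pencil's point `s = 0` lies in the ball class (`hK`, `0 < 2 ≤ ϱ`) and
`ROp k < R′ k` (`hroom`)).  Every other binder is N0p's VERBATIM: operator letters `hm`∕`hN`∕`hq` at the class centres and the room
`hroom` (rows NE2∕NE3's Gaussian data as row NE5 displays them), the table pencil `hc` on `‖s‖ < ϱ` (`hcurve`, `hK`, radius `hR`),
carrier placement `hscale`, term indexing `hact`, geometry `G`, clauses `hrate`∕`hsmall`, `5r₁ ≤ b₅`, N0m's `hϱ`∕`hϱA`.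
Conclusion: `‖E[act 1](X₀) − E[act 0](X₀)‖ ≤ 4·(e ν c₁ K₀²)·A₁·e^{−r₁ d(X₀)}`. [folklore] -/
theorem attachedPart_locE_le_of_cores_mass {W : Set (ℕ → ℝ)} {ctr : ℕ → (ℕ → ℝ) → C.BgB → Op × B13HistM P}
    {ROp RHist R' : ℕ → ℝ} (𝔊 : ∀ k i, C.Dom → BiCore P dom Op (β k i) (α k i)) {mq bq N₀ : ℕ → ι → C.Dom → ℝ}
    (hroom : ∀ k, ROp k < R' k)
    (hm : ∀ k, ∀ g ∈ W, ∀ (U : C.BgB) (X : C.Dom), C.scale X = k → ∀ i, 0 < mq k i X)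
    (hN : ∀ k, ∀ g ∈ W, ∀ (U : C.BgB) (X : C.Dom), C.scale X = k → ∀ i,
      (∀ o ∈ ball (ctr k g U).1 (R' k), AEStronglyMeasurable ((𝔊 k i X).N o) (𝔊 k i X).lam) ∧
      (∀ p, DifferentiableOn ℂ (fun o => (𝔊 k i X).N o p) (ball (ctr k g U).1 (R' k))) ∧
      (∀ o ∈ ball (ctr k g U).1 (R' k), ∀ p, ‖(𝔊 k i X).N o p‖ ≤ N₀ k i X))
    (hq : ∀ k, ∀ g ∈ W, ∀ (U : C.BgB) (X : C.Dom), C.scale X = k → ∀ i,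
      (∀ o ∈ ball (ctr k g U).1 (R' k),
        AEStronglyMeasurable (Function.uncurry ((𝔊 k i X).q o)) ((𝔊 k i X).lam.prod volume)) ∧
      (∀ p v, DifferentiableOn ℂ (fun o => (𝔊 k i X).q o p v) (ball (ctr k g U).1 (R' k))) ∧
      (∀ o ∈ ball (ctr k g U).1 (R' k), ∀ p v, mq k i X * ‖v‖ ^ 2 - bq k i X ≤ ((𝔊 k i X).q o p v).re))
    {k : ℕ} {g : ℕ → ℝ} (hg : g ∈ W) {U : C.BgB} {o : Op} {hc : ℂ → B13HistM P} {ϱ R₀ : ℝ}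
    (hcurve : DifferentiableOn ℂ hc (ball (0 : ℂ) ϱ))
    (hK : ∀ s ∈ ball (0 : ℂ) ϱ, (o, hc s) ∈ ballClass ctr ROp RHist k g U) (hR : ∀ s ∈ ball (0 : ℂ) ϱ, ‖hc s‖ ≤ R₀)
    {emb : D.Dom → C.Dom} (hscale : ∀ Z, C.scale (emb Z) = k) {terms : D.Dom → Finset ι} {act : ℂ → D.Dom → ℂ}
    (hact : ∀ s ∈ ball (0 : ℂ) ϱ, ∀ Z, act s Z = ∑ i ∈ terms Z, termBi 𝔊 k i o (hc s) (emb Z))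
    {A₀ A₁ R r₁ b₅ : ℝ} {X₀ : D.Dom} (hA₀ : 0 ≤ A₀) (hA₁ : 0 ≤ A₁) (hr₁ : 0 ≤ r₁) (hb : r₁ * 5 ≤ b₅)
    (hrate : r₁ + 2 * G.κ₀ + 2 ≤ R) (hsmall : (A₀ + ϱ * A₁) * Real.exp (b₅ + 1) * G.K₀ * G.ν * G.c₁ ≤ 1)
    (hM3 : ∀ Z, G.cubes Z ⊆ G.cubes X₀ →
      ∑ i ∈ terms Z, (𝔊 k i (emb Z)).lam.real univ * ((𝔊 k i (emb Z)).wB * N₀ k i (emb Z) *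
          Real.exp (bq k i (emb Z))) * (Real.pi / (mq k i (emb Z) / 2)) ^ (Module.finrank ℝ (α k i) / 2 : ℝ) *
        Real.exp ((𝔊 k i (emb Z)).N₁ * R₀) ≤ (A₀ + ϱ * A₁) * Real.exp (-(R * D.dj Z)))
    (hϱ : 2 ≤ ϱ) (hϱA : A₀ ≤ ϱ * A₁) :
    ‖locE G.ι G.cubes (act 1) (G.cubes X₀) - locE G.ι G.cubes (act 0) (G.cubes X₀)‖ ≤
      4 * (Real.exp 1 * G.ν * G.c₁ * G.K₀ ^ 2) * A₁ * Real.exp (-(r₁ * D.dj X₀)) := by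
  have h0 : (0 : ℂ) ∈ ball (0 : ℂ) ϱ := mem_ball_self (by linarith)
  have ho : o ∈ ball (ctr k g U).1 (R' k) :=
    mem_ball.2 (lt_of_le_of_lt (mem_closedBall.1 (Set.mem_prod.1 (hK 0 h0)).1) (hroom k))
  refine attachedPart_locE_le_of_cores D G 𝔊 hroom hm hN hq hg hcurve hK hR hscale hact hA₀ hA₁ hr₁ hb hrate hsmall
    (fun Z hZ => le_trans ?_ (hM3 Z hZ)) hϱ hϱA
  simpa only [one_mul] using sum_coreMass_le_sum_letters 𝔊 hm (fun k g hg U X hX i => (hN k g hg U X hX i).2.2)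
    (fun k g hg U X hX i => (hq k g hg U X hX i).2.2) hg ho hscale terms R₀ Z

open Classical in
/-- **THE SAME ALONG THE LINEAR TABLE-STRENGTH PENCIL `s ↦ h₀ + s • w`, (B3) AS A LETTER BUDGET** (kernel; N0p §4's
`attachedPart_locE_le_of_cores_pencil` ONCE BY NAME, `hL3 ↦ hM3` via §2 at the table radius `R₀ := ‖h₀‖ + ϱ·‖w‖`; the operator
point lies in the open letter ball by `hO` and `hroom`).  Pencil data = the two radius inequalities `hO`, `hH`; every other binder
VERBATIM. [folklore] -/
theorem attachedPart_locE_le_of_cores_pencil_mass {W : Set (ℕ → ℝ)} {ctr : ℕ → (ℕ → ℝ) → C.BgB → Op × B13HistM P}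
    {ROp RHist R' : ℕ → ℝ} (𝔊 : ∀ k i, C.Dom → BiCore P dom Op (β k i) (α k i)) {mq bq N₀ : ℕ → ι → C.Dom → ℝ}
    (hroom : ∀ k, ROp k < R' k)
    (hm : ∀ k, ∀ g ∈ W, ∀ (U : C.BgB) (X : C.Dom), C.scale X = k → ∀ i, 0 < mq k i X)
    (hN : ∀ k, ∀ g ∈ W, ∀ (U : C.BgB) (X : C.Dom), C.scale X = k → ∀ i,
      (∀ o ∈ ball (ctr k g U).1 (R' k), AEStronglyMeasurable ((𝔊 k i X).N o) (𝔊 k i X).lam) ∧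
      (∀ p, DifferentiableOn ℂ (fun o => (𝔊 k i X).N o p) (ball (ctr k g U).1 (R' k))) ∧
      (∀ o ∈ ball (ctr k g U).1 (R' k), ∀ p, ‖(𝔊 k i X).N o p‖ ≤ N₀ k i X))
    (hq : ∀ k, ∀ g ∈ W, ∀ (U : C.BgB) (X : C.Dom), C.scale X = k → ∀ i,
      (∀ o ∈ ball (ctr k g U).1 (R' k),
        AEStronglyMeasurable (Function.uncurry ((𝔊 k i X).q o)) ((𝔊 k i X).lam.prod volume)) ∧
      (∀ p v, DifferentiableOn ℂ (fun o => (𝔊 k i X).q o p v) (ball (ctr k g U).1 (R' k))) ∧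
      (∀ o ∈ ball (ctr k g U).1 (R' k), ∀ p v, mq k i X * ‖v‖ ^ 2 - bq k i X ≤ ((𝔊 k i X).q o p v).re))
    {k : ℕ} {g : ℕ → ℝ} (hg : g ∈ W) {U : C.BgB} {o : Op} {h₀ w : B13HistM P} {ϱ : ℝ}
    (hO : ‖o - (ctr k g U).1‖ ≤ ROp k) (hH : ‖h₀ - (ctr k g U).2‖ + ϱ * ‖w‖ ≤ RHist k)
    {emb : D.Dom → C.Dom} (hscale : ∀ Z, C.scale (emb Z) = k) {terms : D.Dom → Finset ι} {act : ℂ → D.Dom → ℂ}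
    (hact : ∀ s ∈ ball (0 : ℂ) ϱ, ∀ Z, act s Z = ∑ i ∈ terms Z, termBi 𝔊 k i o (h₀ + s • w) (emb Z))
    {A₀ A₁ R r₁ b₅ : ℝ} {X₀ : D.Dom} (hA₀ : 0 ≤ A₀) (hA₁ : 0 ≤ A₁) (hr₁ : 0 ≤ r₁) (hb : r₁ * 5 ≤ b₅)
    (hrate : r₁ + 2 * G.κ₀ + 2 ≤ R) (hsmall : (A₀ + ϱ * A₁) * Real.exp (b₅ + 1) * G.K₀ * G.ν * G.c₁ ≤ 1)
    (hM3 : ∀ Z, G.cubes Z ⊆ G.cubes X₀ →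
      ∑ i ∈ terms Z, (𝔊 k i (emb Z)).lam.real univ * ((𝔊 k i (emb Z)).wB * N₀ k i (emb Z) *
          Real.exp (bq k i (emb Z))) * (Real.pi / (mq k i (emb Z) / 2)) ^ (Module.finrank ℝ (α k i) / 2 : ℝ) *
        Real.exp ((𝔊 k i (emb Z)).N₁ * (‖h₀‖ + ϱ * ‖w‖)) ≤ (A₀ + ϱ * A₁) * Real.exp (-(R * D.dj Z)))
    (hϱ : 2 ≤ ϱ) (hϱA : A₀ ≤ ϱ * A₁) :
    ‖locE G.ι G.cubes (act 1) (G.cubes X₀) - locE G.ι G.cubes (act 0) (G.cubes X₀)‖ ≤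
      4 * (Real.exp 1 * G.ν * G.c₁ * G.K₀ ^ 2) * A₁ * Real.exp (-(r₁ * D.dj X₀)) := by
  have ho : o ∈ ball (ctr k g U).1 (R' k) := mem_ball.2 (by rw [dist_eq_norm]; exact lt_of_le_of_lt hO (hroom k))
  refine attachedPart_locE_le_of_cores_pencil D G 𝔊 hroom hm hN hq hg hO hH hscale hact hA₀ hA₁ hr₁ hb hrate hsmall
    (fun Z hZ => le_trans ?_ (hM3 Z hZ)) hϱ hϱA
  simpa only [one_mul] using sum_coreMass_le_sum_letters 𝔊 hm (fun k g hg U X hX i => (hN k g hg U X hX i).2.2)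
    (fun k g hg U X hX i => (hq k g hg U X hX i).2.2) hg ho hscale terms (‖h₀‖ + ϱ * ‖w‖) Z

/-! ## §3 THE μ-PART (SOURCE PENCIL) ON CORES, and with (B3) as a letter budget -/

open Classical in
/-- **THE μ-PART OF THE DRESSED SMALL-FIELD OUTPUT BUILT FROM (2.14)-CORES** (kernel; N0p §3's `muPart_locE_le_of_expLinear` with
`hexp` DISCHARGED by N0p's `termHistExpLinear_termBi` and the read-out bounds by the cores' letter `N₁` — the source-pencil twin of
N0p §4's `attachedPart_locE_le_of_cores`, which N0p leaves to the reader): along a SOURCE pencil `s ↦ hc s`, `‖s‖ < μ₁` (e.g. the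
first dressed step's `𝐕₀ + s • O`), for `0 < μ₀ < μ₁` and `‖μ‖ ≤ μ₀`,
`‖E[act μ](X₀) − E[act 0](X₀)‖ ≤ (e ν c₁ K₀²·A·e^{−r₁ d(X₀)})·μ₀∕(μ₁ − μ₀)`, the binders being those of
`attachedPart_locE_le_of_cores` with the (2.38)-shape `hL3` at the constant `A`. [folklore] -/
theorem muPart_locE_le_of_cores {W : Set (ℕ → ℝ)} {ctr : ℕ → (ℕ → ℝ) → C.BgB → Op × B13HistM P}
    {ROp RHist R' : ℕ → ℝ} (𝔊 : ∀ k i, C.Dom → BiCore P dom Op (β k i) (α k i)) {mq bq N₀ : ℕ → ι → C.Dom → ℝ}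
    (hroom : ∀ k, ROp k < R' k)
    (hm : ∀ k, ∀ g ∈ W, ∀ (U : C.BgB) (X : C.Dom), C.scale X = k → ∀ i, 0 < mq k i X)
    (hN : ∀ k, ∀ g ∈ W, ∀ (U : C.BgB) (X : C.Dom), C.scale X = k → ∀ i,
      (∀ o ∈ ball (ctr k g U).1 (R' k), AEStronglyMeasurable ((𝔊 k i X).N o) (𝔊 k i X).lam) ∧
      (∀ p, DifferentiableOn ℂ (fun o => (𝔊 k i X).N o p) (ball (ctr k g U).1 (R' k))) ∧
      (∀ o ∈ ball (ctr k g U).1 (R' k), ∀ p, ‖(𝔊 k i X).N o p‖ ≤ N₀ k i X))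
    (hq : ∀ k, ∀ g ∈ W, ∀ (U : C.BgB) (X : C.Dom), C.scale X = k → ∀ i,
      (∀ o ∈ ball (ctr k g U).1 (R' k),
        AEStronglyMeasurable (Function.uncurry ((𝔊 k i X).q o)) ((𝔊 k i X).lam.prod volume)) ∧
      (∀ p v, DifferentiableOn ℂ (fun o => (𝔊 k i X).q o p v) (ball (ctr k g U).1 (R' k))) ∧
      (∀ o ∈ ball (ctr k g U).1 (R' k), ∀ p v, mq k i X * ‖v‖ ^ 2 - bq k i X ≤ ((𝔊 k i X).q o p v).re))
    {k : ℕ} {g : ℕ → ℝ} (hg : g ∈ W) {U : C.BgB} {o : Op} {hc : ℂ → B13HistM P} {μ₁ R₀ : ℝ}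
    (hcurve : DifferentiableOn ℂ hc (ball (0 : ℂ) μ₁))
    (hK : ∀ s ∈ ball (0 : ℂ) μ₁, (o, hc s) ∈ ballClass ctr ROp RHist k g U) (hR : ∀ s ∈ ball (0 : ℂ) μ₁, ‖hc s‖ ≤ R₀)
    {emb : D.Dom → C.Dom} (hscale : ∀ Z, C.scale (emb Z) = k) {terms : D.Dom → Finset ι} {act : ℂ → D.Dom → ℂ}
    (hact : ∀ s ∈ ball (0 : ℂ) μ₁, ∀ Z, act s Z = ∑ i ∈ terms Z, termBi 𝔊 k i o (hc s) (emb Z))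
    {A R r₁ b₅ μ₀ : ℝ} {X₀ : D.Dom} {sμ : ℂ} (hA : 0 ≤ A) (hr₁ : 0 ≤ r₁) (hb : r₁ * 5 ≤ b₅)
    (hrate : r₁ + 2 * G.κ₀ + 2 ≤ R) (hsmall : A * Real.exp (b₅ + 1) * G.K₀ * G.ν * G.c₁ ≤ 1)
    (hL3 : ∀ Z, G.cubes Z ⊆ G.cubes X₀ →
      ∑ i ∈ terms Z, (∫ z, ‖(𝔊 k i (emb Z)).w z.1 * (𝔊 k i (emb Z)).N o z.1 *
          ((𝔊 k i (emb Z)).chi z.2 * cexp (-(𝔊 k i (emb Z)).q o z.1 z.2))‖ ∂((𝔊 k i (emb Z)).lam.prod volume)) *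
        Real.exp ((𝔊 k i (emb Z)).N₁ * R₀) ≤ A * Real.exp (-(R * D.dj Z)))
    (h0 : 0 < μ₀) (h01 : μ₀ < μ₁) (hμ : ‖sμ‖ ≤ μ₀) :
    ‖locE G.ι G.cubes (act sμ) (G.cubes X₀) - locE G.ι G.cubes (act 0) (G.cubes X₀)‖ ≤
      Real.exp 1 * G.ν * G.c₁ * G.K₀ ^ 2 * A * Real.exp (-(r₁ * D.dj X₀)) * (μ₀ / (μ₁ - μ₀)) :=
  muPart_locE_le_of_expLinear D G (termHistExpLinear_termBi 𝔊 hroom hm hN hq) hg hcurve hK hR hscale hact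
    (fun Z i => (𝔊 k i (emb Z)).N₁_nonneg)
    (fun Z i _ => Filter.Eventually.of_forall fun z => (𝔊 k i (emb Z)).norm_readOut_le z.1 z.2)
    hA hr₁ hb hrate hsmall hL3 h0 h01 hμ

open Classical in
/-- **THE μ-PART ON CORES, (B3) AS A LETTER BUDGET** (kernel; `muPart_locE_le_of_cores` with `hL3 ↦ hM3` via §2 — the operator point
lies in the open letter ball because `s = 0` lies in the source disc (`0 < μ₀ < μ₁`) and `hroom`). [folklore] -/
theorem muPart_locE_le_of_cores_mass {W : Set (ℕ → ℝ)} {ctr : ℕ → (ℕ → ℝ) → C.BgB → Op × B13HistM P}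
    {ROp RHist R' : ℕ → ℝ} (𝔊 : ∀ k i, C.Dom → BiCore P dom Op (β k i) (α k i)) {mq bq N₀ : ℕ → ι → C.Dom → ℝ}
    (hroom : ∀ k, ROp k < R' k)
    (hm : ∀ k, ∀ g ∈ W, ∀ (U : C.BgB) (X : C.Dom), C.scale X = k → ∀ i, 0 < mq k i X)
    (hN : ∀ k, ∀ g ∈ W, ∀ (U : C.BgB) (X : C.Dom), C.scale X = k → ∀ i,
      (∀ o ∈ ball (ctr k g U).1 (R' k), AEStronglyMeasurable ((𝔊 k i X).N o) (𝔊 k i X).lam) ∧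
      (∀ p, DifferentiableOn ℂ (fun o => (𝔊 k i X).N o p) (ball (ctr k g U).1 (R' k))) ∧
      (∀ o ∈ ball (ctr k g U).1 (R' k), ∀ p, ‖(𝔊 k i X).N o p‖ ≤ N₀ k i X))
    (hq : ∀ k, ∀ g ∈ W, ∀ (U : C.BgB) (X : C.Dom), C.scale X = k → ∀ i,
      (∀ o ∈ ball (ctr k g U).1 (R' k),
        AEStronglyMeasurable (Function.uncurry ((𝔊 k i X).q o)) ((𝔊 k i X).lam.prod volume)) ∧
      (∀ p v, DifferentiableOn ℂ (fun o => (𝔊 k i X).q o p v) (ball (ctr k g U).1 (R' k))) ∧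
      (∀ o ∈ ball (ctr k g U).1 (R' k), ∀ p v, mq k i X * ‖v‖ ^ 2 - bq k i X ≤ ((𝔊 k i X).q o p v).re))
    {k : ℕ} {g : ℕ → ℝ} (hg : g ∈ W) {U : C.BgB} {o : Op} {hc : ℂ → B13HistM P} {μ₁ R₀ : ℝ}
    (hcurve : DifferentiableOn ℂ hc (ball (0 : ℂ) μ₁))
    (hK : ∀ s ∈ ball (0 : ℂ) μ₁, (o, hc s) ∈ ballClass ctr ROp RHist k g U) (hR : ∀ s ∈ ball (0 : ℂ) μ₁, ‖hc s‖ ≤ R₀)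
    {emb : D.Dom → C.Dom} (hscale : ∀ Z, C.scale (emb Z) = k) {terms : D.Dom → Finset ι} {act : ℂ → D.Dom → ℂ}
    (hact : ∀ s ∈ ball (0 : ℂ) μ₁, ∀ Z, act s Z = ∑ i ∈ terms Z, termBi 𝔊 k i o (hc s) (emb Z))
    {A R r₁ b₅ μ₀ : ℝ} {X₀ : D.Dom} {sμ : ℂ} (hA : 0 ≤ A) (hr₁ : 0 ≤ r₁) (hb : r₁ * 5 ≤ b₅)
    (hrate : r₁ + 2 * G.κ₀ + 2 ≤ R) (hsmall : A * Real.exp (b₅ + 1) * G.K₀ * G.ν * G.c₁ ≤ 1)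
    (hM3 : ∀ Z, G.cubes Z ⊆ G.cubes X₀ →
      ∑ i ∈ terms Z, (𝔊 k i (emb Z)).lam.real univ * ((𝔊 k i (emb Z)).wB * N₀ k i (emb Z) *
          Real.exp (bq k i (emb Z))) * (Real.pi / (mq k i (emb Z) / 2)) ^ (Module.finrank ℝ (α k i) / 2 : ℝ) *
        Real.exp ((𝔊 k i (emb Z)).N₁ * R₀) ≤ A * Real.exp (-(R * D.dj Z)))
    (h0 : 0 < μ₀) (h01 : μ₀ < μ₁) (hμ : ‖sμ‖ ≤ μ₀) :
    ‖locE G.ι G.cubes (act sμ) (G.cubes X₀) - locE G.ι G.cubes (act 0) (G.cubes X₀)‖ ≤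
      Real.exp 1 * G.ν * G.c₁ * G.K₀ ^ 2 * A * Real.exp (-(r₁ * D.dj X₀)) * (μ₀ / (μ₁ - μ₀)) := by
  have hs0 : (0 : ℂ) ∈ ball (0 : ℂ) μ₁ := mem_ball_self (h0.trans h01)
  have ho : o ∈ ball (ctr k g U).1 (R' k) :=
    mem_ball.2 (lt_of_le_of_lt (mem_closedBall.1 (Set.mem_prod.1 (hK 0 hs0)).1) (hroom k))
  refine muPart_locE_le_of_cores D G 𝔊 hroom hm hN hq hg hcurve hK hR hscale hact hA hr₁ hb hrate hsmall
    (fun Z hZ => le_trans ?_ (hM3 Z hZ)) h0 h01 hμ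
  simpa only [one_mul] using sum_coreMass_le_sum_letters 𝔊 hm (fun k g hg U X hX i => (hN k g hg U X hX i).2.2)
    (fun k g hg U X hX i => (hq k g hg U X hX i).2.2) hg ho hscale terms R₀ Z

end Cores

end Summit.QuantumFields.BalabanUV.T4Continuum.NE1p.DressedSmallFieldOnCoresMass

end
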